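import Mathlib
import HarnessLib
import Summits.Langlands.Langlands.Theses.HybridParityDefect

/-!
# Birth skeleton (BC3) for crux stmt-Langlands-17966
`Summit.Langlands.Langlands.Theses.HybridParityDefect.HybridDefectWitness` — line `birth`

Route `route-Langlands-HybridParityDefect` (refutation shape: `closes (h₁ : HybridDefectWitness)
(h₂ : HybridDictionary) (h₃ : ArtinAvatarSupply) : ¬ Langlands`; this crux is `h₁`, rank 2, the
deciding computational bet). THE CRUX: over the golden field `F = ℚ(√5)` (typed `Golden`: `finrank ℚ F = 2`,
`a² = 5`, two distinct real embeddings `ι₁ ≠ ι₂`, `0 < ι₁ a`) there is a framed Artin representation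
`σ : Γ_F → GL₂(ℂ)` of MIXED PARITY with finite insoluble image (`MixedIco`: irreducible, finite range,
non-solvable image, signature `(1,1)` at `ι₁`, first signature entry `≠ 1` at `ι₂`) and conductor norm
`≤ 10¹⁰` whose Galois-predicted hybrid weight-one ⊗ Maass series `series F a ι₁ ι₂ σ` (the `tsum` over
`ξ : F` of `term … ξ`) is NOT weight-`(1,0)` automorphic under `Γ₁(𝔣(σ)) ∩ SL₂(𝓞)` (`¬ HybridAut`).

This file concludes the crux BY NAME from two named stubs along the route's own two-layer plan
(`HybridDefectWitness ⇐ TailConvergence → DefectCertificate`, glued by a limit argument):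

* `stub_tailConvergence` (M; analytic) — for golden data and a mixed-parity icosahedral `σ` the hybrid
  series is (unconditionally) SUMMABLE over `ξ : F` at every point of `ℍ × ℍ`: the coefficients vanish off
  the cone `{ξ ∈ a⁻¹𝓞 = 𝔡⁻¹ : ι₁ ξ > 0}`, the Artin Dirichlet coefficients of a finite-image `σ` satisfy
  `|a_σ(𝔪)| ≤ d(𝔪) ≤ N(𝔪) = 5|ι₁ξ · ι₂ξ|` (inverse Euler factors with root-of-unity inverse roots), and
  `e^{-2π ι₁ξ y₁} √y₂ K₀(2π|ι₂ξ| y₂)` decays exponentially in both lattice coordinates (`K₀(x) ≤ √(π/2x) e^{-x}`,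
  `|ι₁ξ ι₂ξ| ≥ 1/5` on the dual lattice keeps `K₀`'s logarithmic singularity away); lattice-point counting
  in boxes is polynomial. This is exactly what makes the `tsum` in the crux a genuine value (no junk `0`).
* `stub_defectCertificate` (L; THE BET, the certificate form of the crux) — there are golden data, a
  mixed-parity icosahedral `σ` of conductor norm `≤ 10¹⁰`, an element `(α β; γ δ) ∈ SL₂(𝓞)` with `γ ∈ 𝔣(σ)`,
  `α ≡ δ ≡ 1 mod 𝔣(σ)`, a point `(z₁, z₂) ∈ ℍ × ℍ`, a margin `η > 0` and a finite truncation `T₀ ⊂ F` such that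
  for EVERY finite `T ⊇ T₀` the TRUNCATED automorphy defect
  `‖Σ_{ξ∈T} term(γ·z) ξ − (ι₁(γ) z₁ + ι₁(δ)) · Σ_{ξ∈T} term(z) ξ‖` is at least `η`. In practice: ONE
  ball-arithmetic evaluation of the two truncations over `T₀` (lattice points in a box sized by the working
  precision) showing a defect `≥ η + (explicit tail bounds for both points)`, plus the explicit tail bound
  (the quantitative form of stub 1) to pass from `T₀` to every `T ⊇ T₀`. Expected FALSE by reciprocity
  (then the FALSE-certificate closes the route `refuted:HybridDefectWitness`); vacuous-false if no
  mixed-parity icosahedral `σ` of conductor norm `≤ 10¹⁰` exists over `ℚ(√5)`.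
* `HybridDefectWitness_of : stubs → HybridDefectWitness` — kernel-checked, no `sorry`: take the data of
  stub 2; were `f_σ` hybrid-automorphic, the identity `series(γ·z) = (ι₁(γ)z₁ + ι₁(δ)) · series(z)` would
  hold at the certified point (the Möbius images lie in `ℍ` because `ι₁, ι₂` are real ring maps and
  `αδ − βγ = 1`: `Im(γ·z) = Im z / |ι(γ)z + ι(δ)|²`, proved here as `act_im_pos`); by stub 1 the partial sums
  over finite `T ⊂ F` tend (along `atTop`) to both series values, so the truncated defect tends to the
  defect of the series, which is `0`; but it is eventually `≥ η > 0` (`ge_of_tendsto`) — contradiction.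

Shape (for `ledger skeleton check`): stubs are `theorem stub_<name> (binders) : <goal> := by sorry`;
`_Goal.stub_<name> : Prop := type_of% @stub_<name>` names each statement; the composition takes
`(h₁ : _Goal.stub_tailConvergence) (h₂ : _Goal.stub_defectCertificate)` and concludes the route decl by
name; the final `example` feeds the two stubs to it. Sorries: exactly the two stubs.

Disproof used: none relevant — the crux has no `Disproof.lean` / Negative lemma (`ledger crux ls
stmt-Langlands-17966`: no workfiles before this one); the four entries of `ledger negatives --problem
Langlands` (SplitPrimeInduction ×2, OrdinaryPrimeTransport, K3KugaSatakeDescent) do not touch hybrid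
series or Artin representations over `ℚ(√5)`. Honoured instead: the route review (refuter, 2026-08-17,
objections A/B): the certificate is stated for ALL truncations `T ⊇ T₀` (so a certified evaluation must come
with its tail bound — no uncontrolled truncation), the Lean artefact of a TRUE-certificate is exactly stub 2
(explicit `FramedArtinRep (ℚ(√5)) 2`, proved conductor bound, in-kernel interval arithmetic — the recorded
research obstruction), and the dihedral CALIBRATION stays outside the cone (kill protocol step 1).
-/

set_option linter.dupNamespace false

noncomputable section

namespace Summit.Langlands.Langlands.Cruxes.HybridDefectWitness.Birth

open Summit.Langlands.Langlands.Theses.HybridParityDefect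
open scoped BigOperators Topology Manifold Classical MeasureTheory ProbabilityTheory Matrix InnerProductSpace ComplexConjugate ContinuousMap
open Filter Set Function TopologicalSpace MeasureTheory
open Literature.NumberTheory.GaloisRepresentations IsDedekindDomain NumberField

/-! ## 0. Named copies of the crux's `let`-bound objects (verbatim; `hybridDefectWitness_iff` is `Iff.rfl`) -/

/-- The Artin Dirichlet coefficient `a_σ(I)` of the ideal `I`: the product over the finite places `v` of the
`v`-adic-valuation-of-`I`-th coefficient of the inverse Euler factor `L_v(σ, T)⁻¹ ∈ ℂ⟦T⟧` (the crux's
`artinCoeff`, verbatim). [cite: MartinetDurham1977, §2] -/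
def artinCoeff (F : Type) [Field F] [NumberField F] (σ : ArtinRep F (Fin 2 → ℂ)) (I : Ideal (𝓞 F)) : ℂ :=
  (by classical exact ∏ᶠ v : HeightOneSpectrum (𝓞 F), PowerSeries.coeff ((Associates.mk v.asIdeal).count (Associates.mk I).factors) ((ArtinRep.eulerFactorAt σ v : PowerSeries ℂ)⁻¹))

/-- The hybrid Fourier coefficient at `ξ : F`: zero unless `ξ a ∈ 𝓞` (i.e. `ξ ∈ 𝔡⁻¹`) and `ι₁ ξ > 0`, else
`a_σ((ξ a))` times the Maass sign `ε₂(ξ) = -1` iff `ι₂ ξ < 0` and `σ(c₂) ≠ +I` (the crux's `coeff`, verbatim).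
[folklore] -/
def coeff (F : Type) [Field F] [NumberField F] (a : F) (ι₁ ι₂ : F →+* ℝ) (σ : FramedArtinRep F 2) (ξ : F) : ℂ :=
  @dite ℂ ((∃ m : 𝓞 F, (m : F) = ξ * a) ∧ 0 < ι₁ ξ) (Classical.dec _)
    (fun h => artinCoeff F σ.toArtinRep (Ideal.span {h.1.choose}) * (if ι₂ ξ < 0 ∧ (ArtinRep.signature σ.toArtinRep ι₂).1 ≠ 2 then -1 else 1))
    (fun _ => 0)

/-- The `ξ`-th TERM of the hybrid series at `(z₁, z₂)`: `coeff ξ · e(ι₁ξ z₁) · √y₂ K₀(2π|ι₂ξ| y₂) · e(ι₂ξ x₂)`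
with `K₀(x) = ∫₀^∞ e^{-x cosh t} dt` (the summand of the crux's `series`, verbatim). [folklore] -/
def term (F : Type) [Field F] [NumberField F] (a : F) (ι₁ ι₂ : F →+* ℝ) (σ : FramedArtinRep F 2)
    (z₁ z₂ : ℂ) (ξ : F) : ℂ :=
  coeff F a ι₁ ι₂ σ ξ * Complex.exp (2 * Real.pi * Complex.I * (ι₁ ξ : ℂ) * z₁) * (((Real.sqrt z₂.im : ℝ) : ℂ) * ((∫ t in Set.Ioi (0 : ℝ), Real.exp (-(2 * Real.pi * |ι₂ ξ| * z₂.im * Real.cosh t)) : ℝ) : ℂ)) * Complex.exp (2 * Real.pi * Complex.I * (ι₂ ξ : ℂ) * (z₂.re : ℂ))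

/-- The hybrid weight-one ⊗ Maass series `f_σ(z₁, z₂) = ∑' ξ : F, term … ξ` (the crux's `series`,
verbatim; Selberg's hybrid forms, Kelmer arXiv:1208.5955 §1). [folklore] -/
def series (F : Type) [Field F] [NumberField F] (a : F) (ι₁ ι₂ : F →+* ℝ) (σ : FramedArtinRep F 2)
    (z₁ z₂ : ℂ) : ℂ :=
  ∑' ξ : F, term F a ι₁ ι₂ σ z₁ z₂ ξ

/-- The Möbius action of `(α β; γ δ)` through the real embedding `ι` (the crux's `act`, verbatim). [folklore] -/
def act (F : Type) [Field F] (ι : F →+* ℝ) (α β γ δ : F) (z : ℂ) : ℂ :=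
  ((ι α : ℂ) * z + (ι β : ℂ)) / ((ι γ : ℂ) * z + (ι δ : ℂ))

/-- HYBRID AUTOMORPHY of `f_σ`: weight-`(1,0)` automorphy under every `(α β; γ δ) ∈ SL₂(𝓞)` with
`γ ∈ 𝔣(σ)`, `α ≡ δ ≡ 1 mod 𝔣(σ)`, at every point of `ℍ × ℍ` (the crux's `HybridAut`, verbatim). [folklore] -/
@[folklore] def HybridAut (F : Type) [Field F] [NumberField F] (a : F) (ι₁ ι₂ : F →+* ℝ) (σ : FramedArtinRep F 2) : Prop :=
  ∀ α β γ δ : 𝓞 F, α * δ - β * γ = 1 → γ ∈ σ.toGaloisRep.artinConductor → α - 1 ∈ σ.toGaloisRep.artinConductor → δ - 1 ∈ σ.toGaloisRep.artinConductor →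
    ∀ z₁ z₂ : ℂ, 0 < z₁.im → 0 < z₂.im →
      series F a ι₁ ι₂ σ (act F ι₁ α β γ δ z₁) (act F ι₂ α β γ δ z₂) = ((ι₁ (γ : F) : ℂ) * z₁ + (ι₁ (δ : F) : ℂ)) * series F a ι₁ ι₂ σ z₁ z₂

/-- MIXED-PARITY ICOSAHEDRAL: irreducible, finite insoluble image, signature `(1,1)` at `ι₁` and even
(`(2,0)` or `(0,2)`) at `ι₂` (the crux's `MixedIco`, verbatim). [folklore] -/
@[folklore] def MixedIco (F : Type) [Field F] [NumberField F] (ι₁ ι₂ : F →+* ℝ) (σ : FramedArtinRep F 2) : Prop :=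
  σ.toGaloisRep.IsIrreducible ∧ (Set.range σ).Finite ∧ ¬ IsSolvable σ.toMonoidHom.range ∧ ArtinRep.signature σ.toArtinRep ι₁ = (1, 1) ∧ (ArtinRep.signature σ.toArtinRep ι₂).1 ≠ 1

/-- GOLDEN DATA: `F` is (a copy of) `ℚ(√5)` with `a = √5 > 0` at `ι₁` and `ι₁ ≠ ι₂` its two real
embeddings (the crux's `Golden`, verbatim). [folklore] -/
@[folklore] def Golden (F : Type) [Field F] [NumberField F] (a : F) (ι₁ ι₂ : F →+* ℝ) : Prop :=
  Module.finrank ℚ F = 2 ∧ a ^ 2 = 5 ∧ ι₁ ≠ ι₂ ∧ 0 < ι₁ a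

/-- The crux unfolded over the named objects (definitional: the crux's `let`s are these defs). [folklore] -/
theorem hybridDefectWitness_iff : HybridDefectWitness ↔
    ∃ (F : Type) (_ : Field F) (_ : NumberField F) (a : F) (ι₁ ι₂ : F →+* ℝ), Golden F a ι₁ ι₂ ∧
      ∃ σ : FramedArtinRep F 2, MixedIco F ι₁ ι₂ σ ∧ σ.toGaloisRep.artinConductorNat ≤ 10 ^ 10 ∧
        ¬ HybridAut F a ι₁ ι₂ σ :=
  Iff.rfl

/-! ## 1. Glue lemma: the Möbius images of `ℍ` under `SL₂(𝓞)` through a real embedding lie in `ℍ` -/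

/-- `Im ((Az+B)/(Cz+D)) = (AD - BC) · Im z / |Cz + D|²` for real `A, B, C, D`; with `AD - BC = ι(αδ - βγ) = 1`
and `Im z > 0` the denominator does not vanish and the image has positive imaginary part. [folklore] -/
theorem act_im_pos {F : Type} [Field F] (ι : F →+* ℝ) {α β γ δ : F} (h : α * δ - β * γ = 1)
    {z : ℂ} (hz : 0 < z.im) : 0 < (act F ι α β γ δ z).im := by
  have hdet : ι α * ι δ - ι β * ι γ = 1 := by simpa using congrArg ι h
  have hw_re : ((ι γ : ℂ) * z + (ι δ : ℂ)).re = ι γ * z.re + ι δ := by simp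
  have hw_im : ((ι γ : ℂ) * z + (ι δ : ℂ)).im = ι γ * z.im := by simp
  have hn_re : ((ι α : ℂ) * z + (ι β : ℂ)).re = ι α * z.re + ι β := by simp
  have hn_im : ((ι α : ℂ) * z + (ι β : ℂ)).im = ι α * z.im := by simp
  have hw0 : ((ι γ : ℂ) * z + (ι δ : ℂ)) ≠ 0 := by
    intro h0
    have hre : ι γ * z.re + ι δ = 0 := by rw [← hw_re, h0, Complex.zero_re]
    have him : ι γ * z.im = 0 := by rw [← hw_im, h0, Complex.zero_im]
    have hγ : ι γ = 0 := by
      rcases mul_eq_zero.mp him with h' | h'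
      · exact h'
      · exact absurd h' hz.ne'
    have hδ : ι δ = 0 := by simpa [hγ] using hre
    have h10 : (1 : ℝ) = 0 := by rw [← hdet, hγ, hδ]; ring
    exact one_ne_zero h10
  have hpos : 0 < Complex.normSq ((ι γ : ℂ) * z + (ι δ : ℂ)) := Complex.normSq_pos.mpr hw0
  have key : (act F ι α β γ δ z).im = z.im / Complex.normSq ((ι γ : ℂ) * z + (ι δ : ℂ)) := by
    unfold act
    rw [Complex.div_im, hn_re, hn_im, hw_re, hw_im, div_sub_div_same]
    congr 1
    linear_combination z.im * hdet
  rw [key]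
  exact div_pos hz hpos

/-! ## 2. The stubs (the ONLY sorries of this file) -/

/-- **STUB 1 — tail convergence: the hybrid series is summable on `ℍ × ℍ`** (M; analytic). For golden data
`(F, a, ι₁, ι₂)` and a mixed-parity icosahedral `σ` the family `ξ ↦ term F a ι₁ ι₂ σ z₁ z₂ ξ` is summable over
`F` whenever `Im z₁, Im z₂ > 0`. Proof route: `coeff ξ = 0` unless `ξ ∈ a⁻¹𝓞 = 𝔡⁻¹` and `ι₁ξ > 0`; for such
`ξ`, `|coeff ξ| = |a_σ((ξ√5))| ≤ d((ξ√5)) ≤ N((ξ√5)) = 5 |ι₁ξ| |ι₂ξ|` (finite image ⇒ the inverse roots of every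
Euler factor `det(1 - T σ(Frob) | V^{I})` are roots of unity, so the `k`-th coefficient of its inverse has
modulus `≤ k + 1`; multiplicativity over `v`); `|e(ι₁ξ z₁)| = e^{-2π ι₁ξ y₁}`, `0 ≤ √y₂ K₀(2π|ι₂ξ|y₂) ≤
√y₂ · C (1 + |log(2π|ι₂ξ|y₂)|) e^{-2π|ι₂ξ|y₂}`, `|e(ι₂ξ x₂)| = 1`; the embedding `ξ ↦ (ι₁ξ, ι₂ξ)` maps `𝔡⁻¹`
onto a lattice of `ℝ²` (`ι₁ ≠ ι₂`) with `|ι₁ξ · ι₂ξ| ≥ 1/5` for `ξ ≠ 0`, so lattice points in the box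
`[0, X] × [-Y, Y]` number `O(XY + 1)` and the doubly exponentially decaying majorant is summable (dyadic
boxes). Why it might fail: only through an unexpected junk convention of the tree's `eulerFactorAt` at
ramified places (the bound `|a_σ(𝔭ᵏ)| ≤ k + 1` uses constant term `1`, `eulerFactorAt_coeff_zero`, and
inverse roots of modulus `≤ 1`). [cite: MartinetDurham1977, §2] -/
theorem stub_tailConvergence (F : Type) [Field F] [NumberField F] (a : F) (ι₁ ι₂ : F →+* ℝ)
    (hg : Golden F a ι₁ ι₂) (σ : FramedArtinRep F 2) (hσ : MixedIco F ι₁ ι₂ σ)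
    (z₁ z₂ : ℂ) (h₁ : 0 < z₁.im) (h₂ : 0 < z₂.im) :
    Summable (term F a ι₁ ι₂ σ z₁ z₂) := by
  sorry

/-- **STUB 2 — the defect certificate** (L; THE BET in certificate form). There are golden data
`(F, a, ι₁, ι₂)`, a mixed-parity icosahedral `σ : Γ_F → GL₂(ℂ)` of Artin conductor norm `≤ 10¹⁰`, an element
`(α β; γ δ) ∈ SL₂(𝓞)` of `Γ₁(𝔣(σ))` (`γ ∈ 𝔣(σ)`, `α - 1, δ - 1 ∈ 𝔣(σ)`), a point `(z₁, z₂)` with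
`Im z₁, Im z₂ > 0`, a margin `η > 0` and a finite set `T₀ ⊂ F` such that for every finite `T ⊇ T₀` the
truncated weight-`(1,0)` automorphy defect `‖Σ_{ξ ∈ T} term(γ·z₁, γ·z₂) ξ − (ι₁(γ) z₁ + ι₁(δ)) Σ_{ξ ∈ T}
term(z₁, z₂) ξ‖ ≥ η`. Pipeline (one kit job chain, the route's): box-search half-real `A₅` quintics over
`ℤ[ω]` with square discriminant and real-root counts `(5 | 1)` at `(ι₂ | ι₁)`; Crespo lift to `2.A₅ ⊂ GL₂(ℂ)`
and minimal-conductor twist; Frobenius classes (Dokchitsers) ⇒ `a_σ(𝔭)`, ramified Euler factors ⇒ all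
`a_σ(𝔪)`; Arb evaluation of both truncations over `T₀ = {ξ ∈ 𝔡⁻¹ : 0 < ι₁ξ ≤ X, |ι₂ξ| ≤ Y}` at heights
`≈ N(𝔣)^{-1/2}` with the explicit tail bound `B(X, Y, z)` of stub 1's majorant; certificate = `defect(T₀) ≥
η + B(γ·z) + |ι₁(γ)z₁ + ι₁(δ)| B(z)`, which gives the claim for every `T ⊇ T₀`. In Lean a TRUE-certificate needs
an explicit `FramedArtinRep F 2` with proved Frobenius data and conductor bound and in-kernel ball
arithmetic for the `K₀`/`exp` sums (route review objection B: the research obstruction). Why it might fail: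
Langlands holds (then `f_σ` is exactly automorphic by the route's `HybridDictionary` and every certified
defect is `≤` tail: the FALSE-certificate closes the route `refuted:HybridDefectWitness`), or no mixed-parity
icosahedral `σ` of conductor norm `≤ 10¹⁰` exists over `ℚ(√5)` (vacuously false).
Sources: Booker–Strömbergsson–Venkatesh 2006 (certification of Maass forms), Crespo 1989
(doi:10.1016/0021-8693(89)90263-6, `2.A₅` liftings), Dokchitser–Dokchitser arXiv:1009.5388 (Frobenius classes).
[cite: BookerStrombergssonVenkatesh2006, §1] -/
theorem stub_defectCertificate :
    ∃ (F : Type) (_ : Field F) (_ : NumberField F) (a : F) (ι₁ ι₂ : F →+* ℝ), Golden F a ι₁ ι₂ ∧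
      ∃ σ : FramedArtinRep F 2, MixedIco F ι₁ ι₂ σ ∧ σ.toGaloisRep.artinConductorNat ≤ 10 ^ 10 ∧
        ∃ α β γ δ : 𝓞 F, α * δ - β * γ = 1 ∧ γ ∈ σ.toGaloisRep.artinConductor ∧
          α - 1 ∈ σ.toGaloisRep.artinConductor ∧ δ - 1 ∈ σ.toGaloisRep.artinConductor ∧
          ∃ z₁ z₂ : ℂ, 0 < z₁.im ∧ 0 < z₂.im ∧ ∃ η : ℝ, 0 < η ∧ ∃ T₀ : Finset F, ∀ T : Finset F, T₀ ⊆ T →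
            η ≤ ‖(∑ ξ ∈ T, term F a ι₁ ι₂ σ (act F ι₁ α β γ δ z₁) (act F ι₂ α β γ δ z₂) ξ) -
                  ((ι₁ (γ : F) : ℂ) * z₁ + (ι₁ (δ : F) : ℂ)) * (∑ ξ ∈ T, term F a ι₁ ι₂ σ z₁ z₂ ξ)‖ := by
  sorry

/-! ## 3. The stub statements as named propositions (hypotheses of the composition, by name) -/

namespace _Goal

/-- The statement of `stub_tailConvergence` (literally its type). [folklore] -/
@[folklore] def stub_tailConvergence : Prop :=
  type_of% @Summit.Langlands.Langlands.Cruxes.HybridDefectWitness.Birth.stub_tailConvergence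

/-- The statement of `stub_defectCertificate` (literally its type). [folklore] -/
@[folklore] def stub_defectCertificate : Prop :=
  type_of% @Summit.Langlands.Langlands.Cruxes.HybridDefectWitness.Birth.stub_defectCertificate

end _Goal

/-! ## 4. Composition (kernel-checked, no `sorry`): STUBS 1–2 ⟹ `HybridDefectWitness` BY NAME -/

/-- **`HybridDefectWitness` from the two stubs.** Take the data of the certificate (stub 2); hybrid
automorphy would give `series(γ·z) = (ι₁(γ)z₁ + ι₁(δ)) · series(z)` at the certified point (the Möbius images
lie in `ℍ`, `act_im_pos`); by stub 1 the finite partial sums tend to both series values along `atTop`, so the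
truncated defect tends to `‖series(γ·z) − (ι₁(γ)z₁ + ι₁(δ)) series(z)‖ = 0`, while it is `≥ η > 0` for all
`T ⊇ T₀` — contradiction (`ge_of_tendsto`). [folklore] -/
theorem HybridDefectWitness_of (h₁ : _Goal.stub_tailConvergence) (h₂ : _Goal.stub_defectCertificate) :
    HybridDefectWitness := by
  have H₁ : ∀ (F : Type) [Field F] [NumberField F] (a : F) (ι₁ ι₂ : F →+* ℝ), Golden F a ι₁ ι₂ →
      ∀ σ : FramedArtinRep F 2, MixedIco F ι₁ ι₂ σ → ∀ z₁ z₂ : ℂ, 0 < z₁.im → 0 < z₂.im →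
        Summable (term F a ι₁ ι₂ σ z₁ z₂) := h₁
  have H₂ : ∃ (F : Type) (_ : Field F) (_ : NumberField F) (a : F) (ι₁ ι₂ : F →+* ℝ), Golden F a ι₁ ι₂ ∧
      ∃ σ : FramedArtinRep F 2, MixedIco F ι₁ ι₂ σ ∧ σ.toGaloisRep.artinConductorNat ≤ 10 ^ 10 ∧
        ∃ α β γ δ : 𝓞 F, α * δ - β * γ = 1 ∧ γ ∈ σ.toGaloisRep.artinConductor ∧
          α - 1 ∈ σ.toGaloisRep.artinConductor ∧ δ - 1 ∈ σ.toGaloisRep.artinConductor ∧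
          ∃ z₁ z₂ : ℂ, 0 < z₁.im ∧ 0 < z₂.im ∧ ∃ η : ℝ, 0 < η ∧ ∃ T₀ : Finset F, ∀ T : Finset F, T₀ ⊆ T →
            η ≤ ‖(∑ ξ ∈ T, term F a ι₁ ι₂ σ (act F ι₁ α β γ δ z₁) (act F ι₂ α β γ δ z₂) ξ) -
                  ((ι₁ (γ : F) : ℂ) * z₁ + (ι₁ (δ : F) : ℂ)) * (∑ ξ ∈ T, term F a ι₁ ι₂ σ z₁ z₂ ξ)‖ := h₂
  rw [hybridDefectWitness_iff]
  obtain ⟨F, _, _, a, ι₁, ι₂, hg, σ, hσ, hN, α, β, γ, δ, hdet, hγ, hα, hδ, z₁, z₂, hz₁, hz₂, η, hη, T₀, hT⟩ :=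
    H₂
  refine ⟨F, _, _, a, ι₁, ι₂, hg, σ, hσ, hN, ?_⟩
  intro haut
  -- the automorphy identity at the certified point
  have heq : series F a ι₁ ι₂ σ (act F ι₁ α β γ δ z₁) (act F ι₂ α β γ δ z₂) =
      ((ι₁ (γ : F) : ℂ) * z₁ + (ι₁ (δ : F) : ℂ)) * series F a ι₁ ι₂ σ z₁ z₂ :=
    haut α β γ δ hdet hγ hα hδ z₁ z₂ hz₁ hz₂
  -- the Möbius images lie in ℍ
  have hdet' : (α : F) * (δ : F) - (β : F) * (γ : F) = 1 := by
    simpa using congrArg (algebraMap (𝓞 F) F) hdet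
  have hw₁ : 0 < (act F ι₁ α β γ δ z₁).im := act_im_pos ι₁ hdet' hz₁
  have hw₂ : 0 < (act F ι₂ α β γ δ z₂).im := act_im_pos ι₂ hdet' hz₂
  -- partial sums tend to the two series values
  have hs : Summable (term F a ι₁ ι₂ σ z₁ z₂) := H₁ F a ι₁ ι₂ hg σ hσ z₁ z₂ hz₁ hz₂
  have hs' : Summable (term F a ι₁ ι₂ σ (act F ι₁ α β γ δ z₁) (act F ι₂ α β γ δ z₂)) :=
    H₁ F a ι₁ ι₂ hg σ hσ _ _ hw₁ hw₂
  have ht : Tendsto (fun T : Finset F => ∑ ξ ∈ T, term F a ι₁ ι₂ σ z₁ z₂ ξ) atTop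
      (𝓝 (series F a ι₁ ι₂ σ z₁ z₂)) := hs.hasSum
  have ht' : Tendsto (fun T : Finset F => ∑ ξ ∈ T, term F a ι₁ ι₂ σ (act F ι₁ α β γ δ z₁) (act F ι₂ α β γ δ z₂) ξ)
      atTop (𝓝 (series F a ι₁ ι₂ σ (act F ι₁ α β γ δ z₁) (act F ι₂ α β γ δ z₂))) := hs'.hasSum
  -- hence the truncated defect tends to the defect of the series, which vanishes
  have hD : Tendsto (fun T : Finset F => ‖(∑ ξ ∈ T, term F a ι₁ ι₂ σ (act F ι₁ α β γ δ z₁) (act F ι₂ α β γ δ z₂) ξ) -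
        ((ι₁ (γ : F) : ℂ) * z₁ + (ι₁ (δ : F) : ℂ)) * (∑ ξ ∈ T, term F a ι₁ ι₂ σ z₁ z₂ ξ)‖) atTop
      (𝓝 ‖series F a ι₁ ι₂ σ (act F ι₁ α β γ δ z₁) (act F ι₂ α β γ δ z₂) -
        ((ι₁ (γ : F) : ℂ) * z₁ + (ι₁ (δ : F) : ℂ)) * series F a ι₁ ι₂ σ z₁ z₂‖) :=
    (ht'.sub (ht.const_mul _)).norm
  have h0 : ‖series F a ι₁ ι₂ σ (act F ι₁ α β γ δ z₁) (act F ι₂ α β γ δ z₂) -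
      ((ι₁ (γ : F) : ℂ) * z₁ + (ι₁ (δ : F) : ℂ)) * series F a ι₁ ι₂ σ z₁ z₂‖ = 0 := by
    rw [heq, sub_self, norm_zero]
  -- but it is eventually at least η > 0
  have hev : ∀ᶠ T : Finset F in atTop, η ≤ ‖(∑ ξ ∈ T, term F a ι₁ ι₂ σ (act F ι₁ α β γ δ z₁) (act F ι₂ α β γ δ z₂) ξ) -
      ((ι₁ (γ : F) : ℂ) * z₁ + (ι₁ (δ : F) : ℂ)) * (∑ ξ ∈ T, term F a ι₁ ι₂ σ z₁ z₂ ξ)‖ :=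
    eventually_atTop.2 ⟨T₀, fun T hT₀ => hT T hT₀⟩
  have hle : η ≤ ‖series F a ι₁ ι₂ σ (act F ι₁ α β γ δ z₁) (act F ι₂ α β γ δ z₂) -
      ((ι₁ (γ : F) : ℂ) * z₁ + (ι₁ (δ : F) : ℂ)) * series F a ι₁ ι₂ σ z₁ z₂‖ := ge_of_tendsto hD hev
  rw [h0] at hle
  exact absurd hle (not_le.mpr hη)

/-- By-name sanity check (an `example`, not a declaration): the two stubs feed the composition. -/
example : HybridDefectWitness :=
  HybridDefectWitness_of stub_tailConvergence stub_defectCertificate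

end Summit.Langlands.Langlands.Cruxes.HybridDefectWitness.Birth

end
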